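import Summits.HodgeConjecture.HodgeConjecture.Theses.HeckeOrbitCompactness
import Literature.AlgebraicGeometry.HodgeTheory.GysinFormalismCorrespondences
import Literature.AlgebraicGeometry.HodgeTheory.ClassesSupportedOn

/-!
# Birth skeleton (BC3) for piece `OrbitKTransport` of the K-saturation split of `OrbitDegreeBound`
(stmt-HodgeConjecture-13689, route HeckeOrbitCompactness; crux-strategist 2026-08-17).

Stubs: `stub_preimageAdmissible` (the geometric heart, for `(x,y) ≠ (0,0)`: the preimage under `x·𝟙 + y·φ` of the support
of an admissible `M`-bounded tuple lies in the support of an admissible `M'`-bounded tuple, `M'`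
uniform along the orbit — Rosati bookkeeping `(x + yφ)^*P ≡ (x² + dy²)P`, `Pic⁰`-padding into
`|k'P|`, Bertini properness) `stub_zeroPullback` (the degenerate member `ψ = 0` kills `H²ⁿ`, `n ≥ 1`), and the kernel-transport
lemma `stub_kerTransport` (PROVED here from `complexBetti.restrictCompl_map_eq_zero` and
`restrictCompl_eq_comp`). `OrbitKTransport_of`: case split on `(x,y) = (0,0)`, else generator-by-generator
(`iSup_le` in comap form).
-/

-- `Summit.<Summit>.<Problem>` is the tree's mandated summit-side namespace (CONVENTIONS §2); deliberate duplicate.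
set_option linter.dupNamespace false

namespace Summit.HodgeConjecture.HodgeConjecture.Cruxes.OrbitDegreeBound.OrbitKTransport

open CategoryTheory
open Literature.AlgebraicGeometry Literature.AlgebraicGeometry.Motives
open Literature.AlgebraicGeometry.HodgeTheory
open Literature.AlgebraicTopology.SingularHomology

/-- Local copy of the piece (child item of the split; same text as filed). -/
def OrbitKTransport : Prop :=
  ∀ (n d t t' x y M : ℕ), 1 ≤ n → 0 < d → ∃ M' : ℕ, ∀ (B₀ : Literature.AlgebraicGeometry.Motives.AbelianVariety ℂ) (PB : Literature.AlgebraicGeometry.Motives.CartierDivisor B₀.X.left) [AlgebraicGeometry.IsDominant (Literature.AlgebraicGeometry.Motives.AbelianVariety.Hom.toSchemeHom (Literature.AlgebraicGeometry.Motives.AbelianVariety.fst B₀ B₀))] [AlgebraicGeometry.IsDominant (Literature.AlgebraicGeometry.Motives.AbelianVariety.Hom.toSchemeHom (Literature.AlgebraicGeometry.Motives.AbelianVariety.snd B₀ B₀))], B₀.dim = n → PB.IsAmple → PB.IsSection 1 → PB.h0 ℂ = t → ∀ (A : Literature.AlgebraicGeometry.Motives.AbelianVariety ℂ) (g : B₀.prod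 B₀ ⟶ A) (φ : A ⟶ A) (P : Literature.AlgebraicGeometry.Motives.CartierDivisor A.X.left) (N : ℕ) [AlgebraicGeometry.IsDominant (Literature.AlgebraicGeometry.Motives.AbelianVariety.Hom.toSchemeHom g)], Literature.AlgebraicGeometry.Motives.AbelianVariety.IsIsogeny g → A.dim = 2 * n → Literature.AlgebraicGeometry.Motives.IsSmoothProjective (2 * n) A.X → 1 ≤ N → CategoryTheory.CategoryStruct.comp (Literature.AlgebraicGeometry.Motives.AbelianVariety.prodLift (-(d • Literature.AlgebraicGeometry.Motives.AbelianVariety.snd B₀ B₀)) (Literature.AlgebraicGeometry.Motives.AbelianVariety.fst B₀ B₀)) g = CategoryTheory.CategoryStruct.comp g φ → CategoryTheory.CategoryStruct.comp φ φ = -(d • CategoryTheory.CategoryStruct.id A) → P.IsAmple → P.IsSection 1 → P.h0 ℂ = t' → (P.pullback (Literature.AlgebraicGeometry.Motives.AbelianVariety.Hom.toSchemeHom g)).LinEquiv (N • (PB.pullback (Literature.AlgebraicGeometry.Motives.AbelianVariety.Hom.toSchemeHom (Literature.AlgebraicGeometry.Motives.AbelianVariety.fst B₀ B₀)) + d • PB.pullback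 (Literature.AlgebraicGeometry.Motives.AbelianVariety.Hom.toSchemeHom (Literature.AlgebraicGeometry.Motives.AbelianVariety.snd B₀ B₀)))) → ∀ c : Literature.AlgebraicGeometry.HodgeTheory.complexBetti A.X (2 * n), (c ∈ ⨆ (D : Fin n → Literature.AlgebraicGeometry.Motives.CartierDivisor A.X.left) (_ : ∀ i, (D i).IsSection 1 ∧ ∃ k : ℕ, k ≤ M ∧ (D i).LinEquiv (k • P)) (_ : ∀ z ∈ {z | ∀ i, ¬ (D i).Avoids z}, ((n : ℕ) : ℕ∞) ≤ Order.coheight z), LinearMap.ker (Literature.AlgebraicGeometry.HodgeTheory.complexBetti.restrictCompl A.X {z | ∀ i, ¬ (D i).Avoids z} (2 * n)).hom) → Literature.AlgebraicTopology.SingularHomology.singularCohomology.map ℂ ℂ (Literature.AlgebraicGeometry.Motives.AlgPoints.mapContinuous (L := ℂ) (x • CategoryTheory.CategoryStruct.id A + y • φ).hom.hom.hom) (2 * n) c ∈ ⨆ (D : Fin n → Literature.AlgebraicGeometry.Motives.CartierDivisor A.X.left) (_ : ∀ i, (D i).IsSection 1 ∧ ∃ k : ℕ, k ≤ M' ∧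 (D i).LinEquiv (k • P)) (_ : ∀ z ∈ {z | ∀ i, ¬ (D i).Avoids z}, ((n : ℕ) : ℕ∞) ≤ Order.coheight z), LinearMap.ker (Literature.AlgebraicGeometry.HodgeTheory.complexBetti.restrictCompl A.X {z | ∀ i, ¬ (D i).Avoids z} (2 * n)).hom

/-- STUB (L): for `(x, y) ≠ (0, 0)` — so that `ψ = x·𝟙 + y·φ` is an isogeny — preimages of admissible
`M`-bounded supports under `ψ` lie in admissible `M'`-bounded supports, `M'` uniform along the orbit
(at `(0,0)` the statement would be false: `ψ` is constant and `ψ⁻¹` of a support through the origin is all of `A`). -/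
theorem stub_preimageAdmissible : ∀ (n d t t' x y M : ℕ), 1 ≤ n → 0 < d → 0 < x + y → ∃ M' : ℕ, ∀ (B₀ : Literature.AlgebraicGeometry.Motives.AbelianVariety ℂ) (PB : Literature.AlgebraicGeometry.Motives.CartierDivisor B₀.X.left) [AlgebraicGeometry.IsDominant (Literature.AlgebraicGeometry.Motives.AbelianVariety.Hom.toSchemeHom (Literature.AlgebraicGeometry.Motives.AbelianVariety.fst B₀ B₀))] [AlgebraicGeometry.IsDominant (Literature.AlgebraicGeometry.Motives.AbelianVariety.Hom.toSchemeHom (Literature.AlgebraicGeometry.Motives.AbelianVariety.snd B₀ B₀))], B₀.dim = n → PB.IsAmple → PB.IsSection 1 → PB.h0 ℂ = t → ∀ (A : Literature.AlgebraicGeometry.Motives.AbelianVariety ℂ) (g : B₀.prod B₀ ⟶ A) (φ : A ⟶ A) (P : Literature.AlgebraicGeometry.Motives.CartierDivisor A.X.left) (N : ℕ) [AlgebraicGeometry.IsDominant (Literature.AlgebraicGeometry.Motives.AbelianVariety.Hom.toSchemeHom g)], Literature.AlgebraicGeometry.Motives.AbelianVariety.IsIsogeny g → A.dim = 2 * n →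 Literature.AlgebraicGeometry.Motives.IsSmoothProjective (2 * n) A.X → 1 ≤ N → CategoryTheory.CategoryStruct.comp (Literature.AlgebraicGeometry.Motives.AbelianVariety.prodLift (-(d • Literature.AlgebraicGeometry.Motives.AbelianVariety.snd B₀ B₀)) (Literature.AlgebraicGeometry.Motives.AbelianVariety.fst B₀ B₀)) g = CategoryTheory.CategoryStruct.comp g φ → CategoryTheory.CategoryStruct.comp φ φ = -(d • CategoryTheory.CategoryStruct.id A) → P.IsAmple → P.IsSection 1 → P.h0 ℂ = t' → (P.pullback (Literature.AlgebraicGeometry.Motives.AbelianVariety.Hom.toSchemeHom g)).LinEquiv (N • (PB.pullback (Literature.AlgebraicGeometry.Motives.AbelianVariety.Hom.toSchemeHom (Literature.AlgebraicGeometry.Motives.AbelianVariety.fst B₀ B₀)) + d • PB.pullback (Literature.AlgebraicGeometry.Motives.AbelianVariety.Hom.toSchemeHom (Literature.AlgebraicGeometry.Motives.AbelianVariety.snd B₀ B₀)))) → ∀ (D : Fin n → Literature.AlgebraicGeometry.Motives.CartierDivisor A.X.left), (∀ i, (D i).IsSection 1 ∧ ∃ k : ℕ, k ≤ M ∧ (D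 i).LinEquiv (k • P)) → (∀ z ∈ {z | ∀ i, ¬ (D i).Avoids z}, ((n : ℕ) : ℕ∞) ≤ Order.coheight z) → ∃ D' : Fin n → Literature.AlgebraicGeometry.Motives.CartierDivisor A.X.left, (∀ i, (D' i).IsSection 1 ∧ ∃ k : ℕ, k ≤ M' ∧ (D' i).LinEquiv (k • P)) ∧ (∀ z ∈ {z | ∀ i, ¬ (D' i).Avoids z}, ((n : ℕ) : ℕ∞) ≤ Order.coheight z) ∧ (Literature.AlgebraicGeometry.Motives.AbelianVariety.Hom.toSchemeHom (x • CategoryTheory.CategoryStruct.id A + y • φ)).base ⁻¹' {z | ∀ i, ¬ (D i).Avoids z} ⊆ {z | ∀ i, ¬ (D' i).Avoids z} := by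
  sorry

/-- STUB (S–M): the degenerate member `(x, y) = (0, 0)` of the order: pull-back along the ZERO endomorphism
kills `H²ⁿ(A(ℂ); ℂ)` for `n ≥ 1` (it factors through the origin `Spec ℂ → A`, and `H^{>0}` of a point vanishes). -/
theorem stub_zeroPullback : ∀ (n : ℕ), 1 ≤ n → ∀ (A : Literature.AlgebraicGeometry.Motives.AbelianVariety ℂ) (φ : A ⟶ A) (c : Literature.AlgebraicGeometry.HodgeTheory.complexBetti A.X (2 * n)), Literature.AlgebraicTopology.SingularHomology.singularCohomology.map ℂ ℂ (Literature.AlgebraicGeometry.Motives.AlgPoints.mapContinuous (L := ℂ) ((0 : ℕ) • CategoryTheory.CategoryStruct.id A + (0 : ℕ) • φ).hom.hom.hom) (2 * n) c = 0 := by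
  sorry

/-- LEMMA (was stub 2; PROVED here from the tree's plumbing): a class vanishing off `Z` pulls
back along `ψ` to a class vanishing off every `Z' ⊇ ψ⁻¹Z` — `complexBetti.restrictCompl_map_eq_zero`
(restriction commutes with pull-back) and `restrictCompl_eq_comp` (restriction to a smaller open
factors). [cite: GrothendieckTopology1969, §1] -/
theorem stub_kerTransport : ∀ (A : Literature.AlgebraicGeometry.Motives.AbelianVariety ℂ) (ψ : A ⟶ A) (Z Z' : Set A.X.left) (k : ℕ), (Literature.AlgebraicGeometry.Motives.AbelianVariety.Hom.toSchemeHom ψ).base ⁻¹' Z ⊆ Z' → ∀ c : Literature.AlgebraicGeometry.HodgeTheory.complexBetti A.X k, Literature.AlgebraicGeometry.HodgeTheory.complexBetti.restrictCompl A.X Z k c = 0 → Literature.AlgebraicGeometry.HodgeTheory.complexBetti.restrictCompl A.X Z' k (Literature.AlgebraicTopology.SingularHomology.singularCohomology.map ℂ ℂ (Literature.AlgebraicGeometry.Motives.AlgPoints.mapContinuous (L := ℂ) ψ.hom.hom.hom) k c) = 0 := by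
  intro A ψ Z Z' k hsub c hc
  have h1 := complexBetti.restrictCompl_map_eq_zero ψ.hom.hom.hom (T := Z) (i := k) hc
  rw [restrictCompl_eq_comp hsub k, CategoryTheory.comp_apply]
  erw [h1]
  rw [map_zero]

/-- The composition: the stubs give the piece (case `(x,y) = (0,0)` by `stub_zeroPullback`, else
generator-by-generator through `stub_preimageAdmissible` and the kernel transport lemma). -/
theorem OrbitKTransport_of : (∀ (n d t t' x y M : ℕ), 1 ≤ n → 0 < d → 0 < x + y → ∃ M' : ℕ, ∀ (B₀ : Literature.AlgebraicGeometry.Motives.AbelianVariety ℂ) (PB : Literature.AlgebraicGeometry.Motives.CartierDivisor B₀.X.left) [AlgebraicGeometry.IsDominant (Literature.AlgebraicGeometry.Motives.AbelianVariety.Hom.toSchemeHom (Literature.AlgebraicGeometry.Motives.AbelianVariety.fst B₀ B₀))] [AlgebraicGeometry.IsDominant (Literature.AlgebraicGeometry.Motives.AbelianVariety.Hom.toSchemeHom (Literature.AlgebraicGeometry.Motives.AbelianVariety.snd B₀ B₀))], B₀.dim = n → PB.IsAmple → PB.IsSection 1 → PB.h0 ℂ = t → ∀ (A : Literature.AlgebraicGeometry.Motives.AbelianVariety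 ℂ) (g : B₀.prod B₀ ⟶ A) (φ : A ⟶ A) (P : Literature.AlgebraicGeometry.Motives.CartierDivisor A.X.left) (N : ℕ) [AlgebraicGeometry.IsDominant (Literature.AlgebraicGeometry.Motives.AbelianVariety.Hom.toSchemeHom g)], Literature.AlgebraicGeometry.Motives.AbelianVariety.IsIsogeny g → A.dim = 2 * n → Literature.AlgebraicGeometry.Motives.IsSmoothProjective (2 * n) A.X → 1 ≤ N → CategoryTheory.CategoryStruct.comp (Literature.AlgebraicGeometry.Motives.AbelianVariety.prodLift (-(d • Literature.AlgebraicGeometry.Motives.AbelianVariety.snd B₀ B₀)) (Literature.AlgebraicGeometry.Motives.AbelianVariety.fst B₀ B₀)) g = CategoryTheory.CategoryStruct.comp g φ → CategoryTheory.CategoryStruct.comp φ φ = -(d • CategoryTheory.CategoryStruct.id A) → P.IsAmple → P.IsSection 1 → P.h0 ℂ = t' → (P.pullback (Literature.AlgebraicGeometry.Motives.AbelianVariety.Hom.toSchemeHom g)).LinEquiv (N • (PB.pullback (Literature.AlgebraicGeometry.Motives.AbelianVariety.Hom.toSchemeHom (Literature.AlgebraicGeometry.Motives.AbelianVariety.fst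 B₀ B₀)) + d • PB.pullback (Literature.AlgebraicGeometry.Motives.AbelianVariety.Hom.toSchemeHom (Literature.AlgebraicGeometry.Motives.AbelianVariety.snd B₀ B₀)))) → ∀ (D : Fin n → Literature.AlgebraicGeometry.Motives.CartierDivisor A.X.left), (∀ i, (D i).IsSection 1 ∧ ∃ k : ℕ, k ≤ M ∧ (D i).LinEquiv (k • P)) → (∀ z ∈ {z | ∀ i, ¬ (D i).Avoids z}, ((n : ℕ) : ℕ∞) ≤ Order.coheight z) → ∃ D' : Fin n → Literature.AlgebraicGeometry.Motives.CartierDivisor A.X.left, (∀ i, (D' i).IsSection 1 ∧ ∃ k : ℕ, k ≤ M' ∧ (D' i).LinEquiv (k • P)) ∧ (∀ z ∈ {z | ∀ i, ¬ (D' i).Avoids z}, ((n : ℕ) : ℕ∞) ≤ Order.coheight z) ∧ (Literature.AlgebraicGeometry.Motives.AbelianVariety.Hom.toSchemeHom (x • CategoryTheory.CategoryStruct.id A + y • φ)).base ⁻¹' {z | ∀ i, ¬ (D i).Avoids z} ⊆ {z | ∀ i, ¬ (D' i).Avoids z}) → (∀ (n : ℕ), 1 ≤ n → ∀ (A : Literature.AlgebraicGeometry.Motives.AbelianVariety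 ℂ) (φ : A ⟶ A) (c : Literature.AlgebraicGeometry.HodgeTheory.complexBetti A.X (2 * n)), Literature.AlgebraicTopology.SingularHomology.singularCohomology.map ℂ ℂ (Literature.AlgebraicGeometry.Motives.AlgPoints.mapContinuous (L := ℂ) ((0 : ℕ) • CategoryTheory.CategoryStruct.id A + (0 : ℕ) • φ).hom.hom.hom) (2 * n) c = 0) → (∀ (A : Literature.AlgebraicGeometry.Motives.AbelianVariety ℂ) (ψ : A ⟶ A) (Z Z' : Set A.X.left) (k : ℕ), (Literature.AlgebraicGeometry.Motives.AbelianVariety.Hom.toSchemeHom ψ).base ⁻¹' Z ⊆ Z' → ∀ c : Literature.AlgebraicGeometry.HodgeTheory.complexBetti A.X k, Literature.AlgebraicGeometry.HodgeTheory.complexBetti.restrictCompl A.X Z k c = 0 → Literature.AlgebraicGeometry.HodgeTheory.complexBetti.restrictCompl A.X Z' k (Literature.AlgebraicTopology.SingularHomology.singularCohomology.map ℂ ℂ (Literature.AlgebraicGeometry.Motives.AlgPoints.mapContinuous (L := ℂ) ψ.hom.hom.hom) k c) = 0) → OrbitKTransport := by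
  intro h1 h0 h2 n d t t' x y M hn hd
  by_cases hxy : x + y = 0
  · have hx : x = 0 := by omega
    have hy : y = 0 := by omega
    subst hx
    subst hy
    refine ⟨0, ?_⟩
    intro B₀ PB _ _ hB hPBa hPBs hPBt A g φ P N _ hg hA hsp hN hcomm hφ hPa hPs hPt hlin c hc
    rw [h0 n hn A φ c]
    exact zero_mem _
  obtain ⟨M', hM'⟩ := h1 n d t t' x y M hn hd (Nat.pos_of_ne_zero hxy)
  refine ⟨M', ?_⟩
  intro B₀ PB _ _ hB hPBa hPBs hPBt A g φ P N _ hg hA hsp hN hcomm hφ hPa hPs hPt hlin c hc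
  have key : (⨆ (D : Fin n → Literature.AlgebraicGeometry.Motives.CartierDivisor A.X.left) (_ : ∀ i, (D i).IsSection 1 ∧ ∃ k : ℕ, k ≤ M ∧ (D i).LinEquiv (k • P)) (_ : ∀ z ∈ {z | ∀ i, ¬ (D i).Avoids z}, ((n : ℕ) : ℕ∞) ≤ Order.coheight z), LinearMap.ker (Literature.AlgebraicGeometry.HodgeTheory.complexBetti.restrictCompl A.X {z | ∀ i, ¬ (D i).Avoids z} (2 * n)).hom) ≤ Submodule.comap (singularCohomology.map ℂ ℂ
      (AlgPoints.mapContinuous (L := ℂ) (x • 𝟙 A + y • φ).hom.hom.hom) (2 * n)).hom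
      (⨆ (D : Fin n → Literature.AlgebraicGeometry.Motives.CartierDivisor A.X.left) (_ : ∀ i, (D i).IsSection 1 ∧ ∃ k : ℕ, k ≤ M' ∧ (D i).LinEquiv (k • P)) (_ : ∀ z ∈ {z | ∀ i, ¬ (D i).Avoids z}, ((n : ℕ) : ℕ∞) ≤ Order.coheight z), LinearMap.ker (Literature.AlgebraicGeometry.HodgeTheory.complexBetti.restrictCompl A.X {z | ∀ i, ¬ (D i).Avoids z} (2 * n)).hom) := by
    refine iSup_le fun D => iSup_le fun hD => iSup_le fun hZ => fun z hz => ?_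
    rw [LinearMap.mem_ker] at hz
    obtain ⟨D', hD', hZ', hsub⟩ :=
      hM' B₀ PB hB hPBa hPBs hPBt A g φ P N hg hA hsp hN hcomm hφ hPa hPs hPt hlin D hD hZ
    have hz' := h2 A (x • 𝟙 A + y • φ) _ _ (2 * n) hsub z hz
    rw [Submodule.mem_comap]
    exact Submodule.mem_iSup_of_mem D' (Submodule.mem_iSup_of_mem hD'
      (Submodule.mem_iSup_of_mem hZ' (LinearMap.mem_ker.mpr hz')))
  exact key hc

end Summit.HodgeConjecture.HodgeConjecture.Cruxes.OrbitDegreeBound.OrbitKTransport
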